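import Summits.ResolutionOfSingularities.ResolutionOfSingularities.Theorems.HilbertSamuelEliminationSigmaMaxModificationsCorridor3HypersurfacePoints
import HarnessLib

/-!
# [OURS · L1 W4.2] Near = equimultiple for hypersurface germs: the dictionary between the Hilbert-function near
# condition and the multiplicity condition of the ridge-confinement files (campaign s42 of cell res-hironaka,
# LADDER-RESOLUTION rung L; informal crux `RidgeConfinement`, stmt-ResolutionOfSingularities-17845; `--supports`)

HONEST FRAMING. OURS (slot W4.2, prover res-L1-s42-pv-1), a two-line consequence of the chain-w42 helpers
`SigmaMaxModificationsCorridor3.Helpers.hilbertFun_quotient_span_singleton` (`H^{(0)}(R/(g)) = hypersurfaceHFe d m`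
for `R` regular local of embedding dimension `d` and `g` of order exactly `m`) and `hypersurfaceHFe_le_iff` /
`hypersurfaceHFe_injective`. NOTHING here is a statement of H. Hironaka's manuscript [Hironaka2017]. AI review is
weaker than expert review.

## Why it is here

The typed near notion of slot W4.2 (`CampaignW42.IsNearPoint`, file `…CampaignW42Ridge.lean`) is CJS Def. 3.13,
equality of Hilbert(–Samuel) functions; the hypersurface ridge-confinement theorems
(`…CampaignW42RidgeConfinementHypersurface.lean`, `…Local.lean`) take NEAR as «the multiplicity did not drop»
(`ord_{x'} f' ≥ ord_x f`). For hypersurface germs `R/(g)`, `R'/(g')` in regular local rings of the SAME embedding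
dimension (a closed point `x'` of the blow-up over a closed point `x`: `dim 𝒪_{Z',x'} = dim 𝒪_{Z,x}`) the two agree:

* `hilbertFun_hypersurface_le_iff` — `H^{(0)}(R'/(g')) ≤ H^{(0)}(R/(g)) ↔ ord g' ≤ ord g` (CJS Thm. 2.3 / 3.10 read for
  hypersurfaces: the Hilbert function does not increase iff the multiplicity does not);
* `hilbertFun_hypersurface_eq_iff` — **`H^{(0)}(R'/(g')) = H^{(0)}(R/(g)) ↔ ord g' = ord g`**: NEAR ⟺ EQUIMULTIPLE.

(For points of different dimension CJS compare the shifted functions `H^{(φ)}`; not treated here.)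

References (orientation only): V. Cossart, U. Jannsen, S. Saito, LNM 2270 (2020), §2.2, Thm. 2.3, Def. 3.13, Thm. 3.10.
-/

noncomputable section

-- single-conjunct summit: the doubled namespace component `ResolutionOfSingularities` is mandated
set_option linter.dupNamespace false

open IsLocalRing
open Literature.RingTheory.HilbertSamuel
open Summit.ResolutionOfSingularities.ResolutionOfSingularities.Theorems.SigmaMaxModificationsCorridor3.Helpers

namespace Summit.ResolutionOfSingularities.ResolutionOfSingularities.Theorems

namespace CampaignW42

universe u v

variable {R : Type u} [CommRing R] [IsRegularLocalRing R] {R' : Type v} [CommRing R'] [IsRegularLocalRing R']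

/-- **The Hilbert function of a hypersurface germ does not increase iff the multiplicity does not**: for regular local
rings `R`, `R'` of the same embedding dimension `d ≥ 1`, `g ∈ 𝔪^m ∖ 𝔪^{m+1}`, `g' ∈ 𝔪'^{m'} ∖ 𝔪'^{m'+1}`:
`H^{(0)}(R'/(g')) ≤ H^{(0)}(R/(g)) ↔ m' ≤ m`. [folklore] -/
theorem hilbertFun_hypersurface_le_iff {d m m' : ℕ} (hd1 : 1 ≤ d)
    (hd : (maximalIdeal R).spanFinrank = d) (hd' : (maximalIdeal R').spanFinrank = d)
    {g : R} (hg : g ∈ maximalIdeal R ^ m) (hgn : g ∉ maximalIdeal R ^ (m + 1))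
    {g' : R'} (hg' : g' ∈ maximalIdeal R' ^ m') (hgn' : g' ∉ maximalIdeal R' ^ (m' + 1))
    [IsLocalRing (R ⧸ Ideal.span {g})] [IsLocalRing (R' ⧸ Ideal.span {g'})] :
    hilbertFun (R' ⧸ Ideal.span {g'}) ≤ hilbertFun (R ⧸ Ideal.span {g}) ↔ m' ≤ m := by
  rw [hilbertFun_quotient_span_singleton hd hg hgn, hilbertFun_quotient_span_singleton hd' hg' hgn']
  exact hypersurfaceHFe_le_iff hd1

/-- **NEAR ⟺ EQUIMULTIPLE for hypersurface germs of the same embedding dimension**: with the notation of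
`hilbertFun_hypersurface_le_iff`, `H^{(0)}(R'/(g')) = H^{(0)}(R/(g)) ↔ m' = m` — the Hilbert-function near condition
of CJS Def. 3.13 at a closed point of the blow-up of a hypersurface over a closed point is the condition
«`ord_{x'} f' = ord_x f`» used by the ridge-confinement theorems of this campaign. [folklore] -/
theorem hilbertFun_hypersurface_eq_iff {d m m' : ℕ} (hd1 : 1 ≤ d)
    (hd : (maximalIdeal R).spanFinrank = d) (hd' : (maximalIdeal R').spanFinrank = d)
    {g : R} (hg : g ∈ maximalIdeal R ^ m) (hgn : g ∉ maximalIdeal R ^ (m + 1))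
    {g' : R'} (hg' : g' ∈ maximalIdeal R' ^ m') (hgn' : g' ∉ maximalIdeal R' ^ (m' + 1))
    [IsLocalRing (R ⧸ Ideal.span {g})] [IsLocalRing (R' ⧸ Ideal.span {g'})] :
    hilbertFun (R' ⧸ Ideal.span {g'}) = hilbertFun (R ⧸ Ideal.span {g}) ↔ m' = m := by
  rw [hilbertFun_quotient_span_singleton hd hg hgn, hilbertFun_quotient_span_singleton hd' hg' hgn']
  exact (hypersurfaceHFe_injective hd1).eq_iff

end CampaignW42

end Summit.ResolutionOfSingularities.ResolutionOfSingularities.Theorems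

end
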